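import Summits.ResolutionOfSingularities.ResolutionOfSingularities.Theorems.FrobeniusClosingSteerSeparableEvalOrder
import Summits.ResolutionOfSingularities.ResolutionOfSingularities.Theorems.FrobeniusClosingSteerDivisorTriggerTwoChart
import Summits.ResolutionOfSingularities.ResolutionOfSingularities.Theorems.FrobeniusClosingSteerLowOrderChart
import Summits.ResolutionOfSingularities.ResolutionOfSingularities.Theorems.FrobeniusClosingSteerBlowupDerivation
import Summits.ResolutionOfSingularities.ResolutionOfSingularities.Theorems.FrobeniusClosingSteerNoSingularCarrierRun
import Summits.ResolutionOfSingularities.ResolutionOfSingularities.Theorems.ValuativeLuAlphaPTorsorLocAtCentreDerivations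
import Literature.AlgebraicGeometry.Resolution.RsopMonomialIdeals
import Literature.AlgebraicGeometry.Resolution.QuasiRegularSequences
import Literature.Barriers.Schanuel.NesterenkoModularScopeQuotientDerivation
import HarnessLib

/-!
# Crux `Steer` (stmt-ResolutionOfSingularities-16345), chain W4.1, E-ROW row 9 (R3) `EvenResidueLettersHeavyTwoN`, brick F4 **(T)+(O)**:
# in the σ-CHART of a point blowup at which the residue letter `σ` has MAXIMAL value, the transform `F_σ` of the protector form
# `σ·τ·c² + H` has NO cleaning in `𝔪'^(2e)`

OURS (campaign `res-hironaka`, rung L ★L-G4, slot W4.1; seat res-L0-w41-stub-3 g8, res-L0-w41-plan-1 RULING 266 (e); route = res-L0-w41-idea-2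
`g13/R3-PROOF-MAP.md` eab63904c0a3ca30 §2 (T) + §3 (O) in the LOG-DERIVATION variant (`D₁ ⊇ σ·∂_τ` on `R'`, read modulo `σ`) instead of the chart
identification `R'/σR' ≅ κ[T]_𝔫`; replaces the role of no printed item; NOT a statement of the manuscript under review [claim: Hironaka2017, status: under-review];
AI-produced, weaker than expert review). Theses-free, definition-free.

SETTING. `R = (A₁)_{𝔪_O ∩ A₁} ⊆ K` a regular local member of dimension `4` (`A₁` finitely generated over a perfect field `k` of characteristic `2`, so `R` carries
dual derivations, `PfaffLine.exists_dual_derivations_locAtCentre`), `R'` its local blowing up along `𝔪_R` w.r.t. `O`, `(σ, τ)` part of a regular system of parameters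
with `σ` of MAXIMAL `O`-value on `𝔪_R` (the σ-chart: `R' = (R[𝔪/σ])_{centre}`), `c ∈ (σ,τ)^(e−1) ∖ 𝔪^e`, `N − σ·τ·c² ∈ 𝔪^(2e+1)`, `e ≥ 1`.
CLAIM (`exists_transform_not_sub_sq_mem_pow`): `N = σ^(2e)·F` with `F ∈ R'` and `F − h² ∉ 𝔪_{R'}^(2e)` for EVERY `h ∈ R'`.
PROOF. `F = τ'·c'² + σ·H'` (`τ' = τ/σ`, `c' = Σ a_m τ'^(m₁)` from the binary form `c = Σ a_m σ^(m₀) τ^(m₁)`, `H' = H/σ^(2e+1)`); `D₁ ∈ Der(R')` extends `σ·D_τ`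
(`BlowupDerivation.exists_derivation_smul_localBlowupAlong`), so `D₁ τ' = 1`, `D₁ σ = 0`, `D₁ R ⊆ σR'`, `D₁ F ≡ c'² (mod σ)`; `S̄ = R'/σR'` is regular local
(`DivisorTrigger.isRegularRing_blowupRing_quotient` + `isRegularLocalRing_locAtCentre_quotient`); `c̄' = C(τ̄')` with `C ∈ κ(R)[T]` non-zero of degree `≤ e−1`,
so `c̄' ∉ 𝔫̄^e` (`SeparableEvalOrder.eval₂_not_mem_pow`, with the quotient derivation `D̄₁`, `D̄₁ τ̄' = 1`, `D̄₁ κ = 0`); conclude by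
`RegularOrder.not_sub_sq_mem_pow_of_derivation`. [cite: Matsumura1987, Thm. 17.10, Thm. 30.6] [folklore]
-/

noncomputable section

set_option linter.dupNamespace false

open IsLocalRing MvPolynomial
open Literature.AlgebraicGeometry.Resolution
open Summit.ResolutionOfSingularities.ResolutionOfSingularities.Theorems.SwitchingDichotomy
open Summit.ResolutionOfSingularities.ResolutionOfSingularities.Theorems.PfaffLine (exists_dual_derivations_locAtCentre)

namespace Summit.ResolutionOfSingularities.ResolutionOfSingularities.Theorems.SwitchingDichotomy.EvenResidueSigmaChart

variable {K : Type} [Field K]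

/-! ## §1 Division by powers of the exceptional parameter along the chart -/

/-- Along the local blowing up of `𝔪_R` in the chart of an element `σ` of maximal value, every `y ∈ 𝔪_R^n` is `σ^n · y'` with `y' ∈ R'`. [folklore] -/
theorem exists_eq_pow_mul_of_mem_pow {O : ValuationSubring K} {R R' : Subring K} [IsLocalRing R]
    (hbl : IsLocalBlowupAlong O R (maximalIdeal R) R') {σ : K} (hσR : σ ∈ R) (hσm : (⟨σ, hσR⟩ : R) ∈ maximalIdeal R) (hσ0 : σ ≠ 0)
    (hmax : ∀ y : R, y ∈ maximalIdeal R → O.valuation (y : K) ≤ O.valuation σ) :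
    ∀ (n : ℕ) (y : R), y ∈ maximalIdeal R ^ n → ∃ y' : R', (y : K) = σ ^ n * (y' : K) := by
  have hle : R ≤ R' := hbl.isLocalBlowup.le
  intro n
  induction n with
  | zero => intro y _; exact ⟨⟨y, hle y.2⟩, by simp⟩
  | succ n ih =>
    intro y hy
    rw [pow_succ] at hy
    refine Submodule.mul_induction_on hy (fun a ha b hb => ?_) (fun a b ⟨a', ha'⟩ ⟨b', hb'⟩ => ?_)
    · obtain ⟨a', ha'⟩ := ih a ha
      have hb' : (b : K) / σ ∈ R' := LowOrderChart.div_mem_of_isLocalBlowupAlong hbl hσR hσm hσ0 hmax hb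
      refine ⟨a' * ⟨(b : K) / σ, hb'⟩, ?_⟩
      rw [Subring.coe_mul, ha', Subring.coe_mul]
      field_simp
      ring
    · exact ⟨a' + b', by rw [Subring.coe_add, ha', hb', Subring.coe_add]; ring⟩

/-! ## §2 Binary forms in `(σ, τ)` -/

omit [Field K] in
/-- `range ![σ, τ] = {σ, τ}`. [folklore] -/
theorem range_pair {S : Type} (σ τ : S) : Set.range ![σ, τ] = {σ, τ} := by
  ext a
  simp only [Set.mem_range, Set.mem_insert_iff, Set.mem_singleton_iff]
  constructor
  · rintro ⟨i, rfl⟩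
    fin_cases i <;> simp
  · rintro (rfl | rfl)
    · exact ⟨0, by simp⟩
    · exact ⟨1, by simp⟩

/-! ## §3 The σ-chart transform has no deep cleaning -/

/-- **(T)+(O) — the transform in the σ-chart has NO cleaning in `𝔪'^(2e)`.** See the module docstring. [cite: Matsumura1987, Thm. 17.10, Thm. 30.6] [folklore] -/
theorem exists_transform_not_sub_sq_mem_pow {k : Type} [Field k] [CharP k 2] [PerfectField k] [Algebra k K] [CharP K 2]
    (O : ValuationSubring K) (A₁ : Subalgebra k K) (h₁ : A₁.toSubring ≤ O.toSubring) (hfg : A₁.FG)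
    {R R' : Subring K} [IsLocalRing R] [IsLocalRing R'] (hRA : locAtCentre A₁.toSubring O = R)
    (hreg : IsRegularLocalRing R) (hdim : ringKrullDim R = (4 : ℕ)) (hperf : PerfectField (ResidueField R))
    (hloc : locAtCentre R O = R) (hRO : R ≤ O.toSubring)
    (hbl : IsLocalBlowupAlong O R (maximalIdeal R) R')
    {σ τ c N : R} (hrs : IsRsopPart ![σ, τ]) {e : ℕ} (he : 1 ≤ e)
    (hc : c ∈ Ideal.span {σ, τ} ^ (e - 1)) (hce : c ∉ maximalIdeal R ^ e)
    (hN : N - σ * τ * c ^ 2 ∈ maximalIdeal R ^ (2 * e + 1))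
    (hσmax : ∀ y : R, y ∈ maximalIdeal R → O.valuation (y : K) ≤ O.valuation (σ : K)) :
    ∃ F : R', (N : K) = (σ : K) ^ (2 * e) * (F : K) ∧ ∀ h : R', F - h ^ 2 ∉ maximalIdeal R' ^ (2 * e) := by
  classical
  haveI : Fact (Nat.Prime 2) := ⟨Nat.prime_two⟩
  subst hRA
  haveI := hreg
  haveI := hperf
  obtain ⟨e', rfl⟩ : ∃ e', e = e' + 1 := ⟨e - 1, by omega⟩
  rw [Nat.add_sub_cancel] at hc
  have hle : locAtCentre A₁.toSubring O ≤ R' := hbl.isLocalBlowup.le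
  have hR'O : R' ≤ O.toSubring := hbl.isLocalBlowup.target_le
  have hlocR' : locAtCentre R' O = R' := hbl.isLocalBlowup.locAtCentre_eq
  -- ### the letters
  have hσm : σ ∈ maximalIdeal _ := hrs.mem_maximalIdeal 0
  have hτm : τ ∈ maximalIdeal _ := hrs.mem_maximalIdeal 1
  have hσ2 : σ ∉ maximalIdeal _ ^ 2 := hrs.not_mem_sq 0
  have hσ0' : σ ≠ 0 := hrs.ne_zero 0
  have hσ0 : (σ : K) ≠ 0 := fun h => hσ0' (Subtype.ext h)
  have hval : ∀ a : locAtCentre A₁.toSubring O, a ∈ maximalIdeal _ ↔ O.valuation (a : K) < 1 :=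
    NoSingularCarrier.mem_maximalIdeal_iff_of_locAtCentre_eq hRO hloc
  have hval' : ∀ a : R', a ∈ maximalIdeal R' ↔ O.valuation (a : K) < 1 :=
    NoSingularCarrier.mem_maximalIdeal_iff_of_locAtCentre_eq hR'O hlocR'
  have hvσ : O.valuation (σ : K) < 1 := (hval σ).mp hσm
  -- ### division by powers of `σ` along the chart
  have hdiv := exists_eq_pow_mul_of_mem_pow hbl σ.2 hσm hσ0 hσmax
  -- ### the derivation `D` of the member with `D τ = 1`, `D σ = 0`
  obtain ⟨e₂, x, hfin, hxspan, hxz⟩ := hrs.exists_rsop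
  have hdim' : ringKrullDim (locAtCentre A₁.toSubring O) = ((2 + e₂ : ℕ) : WithBot ℕ∞) := by
    rw [← IsRegularLocalRing.spanFinrank_maximalIdeal, hfin]
  obtain ⟨Dfam, hDfam⟩ := exists_dual_derivations_locAtCentre 2 k K O A₁ h₁ hfg x hxspan hdim'
  set D := Dfam (Fin.castAdd e₂ 1) with hDdef
  have hx0 : x (Fin.castAdd e₂ 0) = σ := by rw [hxz]; rfl
  have hx1 : x (Fin.castAdd e₂ 1) = τ := by rw [hxz]; rfl
  have hDτ : D τ = 1 := by rw [← hx1, hDdef, hDfam, if_pos rfl]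
  have hDσ : D σ = 0 := by
    rw [← hx0, hDdef, hDfam, if_neg]
    intro h
    have := congrArg Fin.val h
    simp at this
  -- ### `D₁ ∈ Der(R')` extending `σ · D`
  obtain ⟨D₁, hD₁⟩ := BlowupDerivation.exists_derivation_smul_localBlowupAlong O _ R' (maximalIdeal _) hbl σ hσm D
  set ι : locAtCentre A₁.toSubring O →+* R' := Subring.inclusion hbl.isLocalBlowup.le with hιdef
  have hι : ∀ a, ((ι a : R') : K) = (a : K) := fun a => rfl
  have hισ0 : ι σ ≠ 0 := fun h => hσ0 (by rw [← hι σ, h]; rfl)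
  have hD₁σ : D₁ (ι σ) = 0 := by rw [hιdef, hD₁, hDσ, mul_zero, map_zero]
  have hD₁mem : ∀ a, D₁ (ι a) ∈ Ideal.span {ι σ} := fun a => by
    rw [hιdef, hD₁, map_mul]
    exact Ideal.mul_mem_right _ _ (Ideal.mem_span_singleton_self _)
  -- ### the σ-chart: `R' = (R[𝔪/σ])_{centre}`, and `S̄ = R'/σR'` is a regular local ring
  have hR' : R' = locAtCentre (blowupRing (locAtCentre A₁.toSubring O) σ) O :=
    DivisorTrigger.eq_locAtCentre_blowupRing hbl σ.2 hσm hσ0 hσmax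
  set I : Ideal R' := Ideal.span {ι σ} with hIdef
  have hIm : I ≤ maximalIdeal R' := by
    rw [hIdef, Ideal.span_le, Set.singleton_subset_iff]
    exact (hval' _).mpr hvσ
  haveI hSreg : IsRegularLocalRing (R' ⧸ I) := by
    have hCO : blowupRing (locAtCentre A₁.toSubring O) (σ : K) ≤ O.toSubring :=
      le_trans (le_locAtCentre _ O) (hR' ▸ hR'O)
    haveI := DivisorTrigger.isRegularRing_blowupRing_quotient (locAtCentre A₁.toSubring O) σ.2 hσm hσ2 hσ0
    have h := DivisorTrigger.isRegularLocalRing_locAtCentre_quotient hCO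
      ⟨(σ : K), le_blowupRing _ (σ : K) σ.2⟩ hvσ
    clear_value ι
    subst hR'
    have hI : I = Ideal.span {algebraMap (blowupRing (locAtCentre A₁.toSubring O) (σ : K))
        (locAtCentre (blowupRing (locAtCentre A₁.toSubring O) (σ : K)) O) ⟨(σ : K), le_blowupRing _ (σ : K) σ.2⟩} := by
      rw [hIdef]
      congr 2
      exact Subtype.ext (by rw [hι]; rfl)
    rw [hI]
    exact h
  set π : R' →+* R' ⧸ I := Ideal.Quotient.mk I with hπdef
  have hπσ : π (ι σ) = 0 := Ideal.Quotient.eq_zero_iff_mem.mpr (Ideal.mem_span_singleton_self _)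
  have hπ : (maximalIdeal R').map π ≤ maximalIdeal (R' ⧸ I) := by
    rw [Ideal.map_le_iff_le_comap]
    intro a ha
    rw [Ideal.mem_comap]
    by_contra hu
    have hu' : IsUnit (π a) := by
      by_contra h
      exact hu ((IsLocalRing.mem_maximalIdeal _).mpr h)
    obtain ⟨b', hb'⟩ := hu'.exists_right_inv
    obtain ⟨b, rfl⟩ := Ideal.Quotient.mk_surjective b'
    have h1 : a * b - 1 ∈ I := by
      rw [← Ideal.Quotient.eq, map_mul, map_one]
      exact hb'
    have : (1 : R') ∈ maximalIdeal R' := by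
      have h2 := Ideal.sub_mem _ (Ideal.mul_mem_right b _ ha) (hIm h1)
      rwa [sub_sub_cancel] at h2
    exact (IsLocalRing.mem_maximalIdeal _).mp this isUnit_one
  -- ### `τ = σ τ'`, `D₁ τ' = 1`
  obtain ⟨τ', hτ'⟩ : ∃ τ' : R', (τ : K) = σ * (τ' : K) := by
    obtain ⟨τ', h⟩ := hdiv 1 τ (by rw [pow_one]; exact hτm)
    exact ⟨τ', by rw [h, pow_one]⟩
  have hιτ : ι τ = ι σ * τ' := Subtype.ext (by rw [Subring.coe_mul, hι, hι]; exact hτ')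
  have hD₁τ' : D₁ τ' = 1 := by
    have h1 : D₁ (ι τ) = ι σ := by rw [hιdef, hD₁, hDτ, mul_one]
    rw [hιτ, Derivation.leibniz, hD₁σ, smul_zero, add_zero, smul_eq_mul] at h1
    exact mul_left_cancel₀ hισ0 (h1.trans (mul_one _).symm)
  -- ### `H := N − στc² = σ^(2e+1) H'`
  obtain ⟨H', hH'⟩ := hdiv (2 * (e' + 1) + 1) _ hN
  -- ### the binary form of `c`, and `c' := Σ a_m τ'^(m₁)` with `c = σ^e' · c'`
  have hrange : Set.range ![σ, τ] = ({σ, τ} : Set (locAtCentre A₁.toSubring O)) := range_pair σ τ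
  obtain ⟨G, hGhom, hGc⟩ := exists_isHomogeneous_of_mem_span_pow ![σ, τ] e' (y := c) (by rw [hrange]; exact hc)
  have hspan_le : Ideal.span (Set.range ![σ, τ]) ≤ maximalIdeal _ := by
    rw [hrange, Ideal.span_le]
    rintro a (rfl | rfl)
    · exact hσm
    · exact hτm
  obtain ⟨m₀, hm₀⟩ : ∃ m₀, G.coeff m₀ ∉ maximalIdeal _ := by
    by_contra hall
    push Not at hall
    apply hce
    have hG : G ∈ Ideal.map (C : _ →+* MvPolynomial (Fin 2) _) (maximalIdeal _) := by
      rw [mem_map_C_iff]; exact hall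
    have h := eval_mem_mul_span_pow ![σ, τ] hGhom hG
    rw [hGc] at h
    have hle' : maximalIdeal (locAtCentre A₁.toSubring O) * Ideal.span (Set.range ![σ, τ]) ^ e' ≤ maximalIdeal _ ^ (e' + 1) := by
      rw [pow_succ']
      exact Ideal.mul_mono_right (Ideal.pow_right_mono hspan_le _)
    exact hle' h
  have hm₀s : m₀ ∈ G.support := MvPolynomial.mem_support_iff.mpr fun h0 => hm₀ (h0 ▸ Ideal.zero_mem _)
  have hdeg : ∀ m ∈ G.support, m 0 + m 1 = e' := fun m hm => by
    have h := hGhom.degree_eq_sum_deg_support hm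
    have hsub : m.support ⊆ Finset.univ := Finset.subset_univ _
    rw [Finset.sum_subset hsub (fun i _ hi => Finsupp.notMem_support_iff.mp hi), Fin.sum_univ_two] at h
    exact h.symm
  set c' : R' := ∑ m ∈ G.support, ι (G.coeff m) * τ' ^ (m 1) with hc'def
  have hcK : (c : K) = ∑ m ∈ G.support, ((G.coeff m : locAtCentre A₁.toSubring O) : K) * (σ : K) ^ (m 0) * (τ : K) ^ (m 1) := by
    have h := congrArg (locAtCentre A₁.toSubring O).subtype hGc
    rw [MvPolynomial.eval_eq', map_sum] at h
    rw [show (c : K) = (locAtCentre A₁.toSubring O).subtype c from rfl, ← h]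
    refine Finset.sum_congr rfl fun m _ => ?_
    rw [Fin.prod_univ_two, map_mul, map_mul, map_pow, map_pow]
    simp only [Matrix.cons_val_zero, Matrix.cons_val_one, mul_assoc]
    rfl
  have hcc' : (c : K) = (σ : K) ^ e' * (c' : K) := by
    have h : (c' : K) = ∑ m ∈ G.support, ((G.coeff m : locAtCentre A₁.toSubring O) : K) * (τ' : K) ^ (m 1) := by
      rw [hc'def]
      change R'.subtype (∑ m ∈ G.support, ι (G.coeff m) * τ' ^ (m 1)) = _
      rw [map_sum]
      refine Finset.sum_congr rfl fun m _ => ?_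
      rw [map_mul, map_pow]; rfl
    rw [hcK, h, Finset.mul_sum]
    refine Finset.sum_congr rfl fun m hm => ?_
    rw [hτ', mul_pow, ← hdeg m hm, pow_add]
    ring
  -- ### `F := τ' c'² + σ H'`
  set F : R' := τ' * c' ^ 2 + ι σ * H' with hFdef
  have hNF : (N : K) = (σ : K) ^ (2 * (e' + 1)) * (F : K) := by
    have hH : ((N : locAtCentre A₁.toSubring O) : K) - (σ : K) * (τ : K) * (c : K) ^ 2 =
        (σ : K) ^ (2 * (e' + 1) + 1) * (H' : K) := by
      rw [← hH']; rfl
    have hF : (F : K) = (τ' : K) * (c' : K) ^ 2 + (σ : K) * (H' : K) := by rw [hFdef]; rfl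
    rw [hF]
    rw [hτ', hcc'] at hH
    have h2e : 2 * (e' + 1) = 2 * e' + 2 := by ring
    rw [h2e]
    linear_combination (exp := 1) hH
  -- ### the residue-field map `φ : κ(R) → S̄` and the quotient derivation
  have hker : ∀ a ∈ maximalIdeal (locAtCentre A₁.toSubring O), (π.comp ι) a = 0 := fun a ha => by
    obtain ⟨a', ha'⟩ := hdiv 1 a (by rw [pow_one]; exact ha)
    rw [RingHom.comp_apply, hπdef, Ideal.Quotient.eq_zero_iff_mem, hIdef]
    refine Ideal.mem_span_singleton'.mpr ⟨a', Subtype.ext ?_⟩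
    rw [Subring.coe_mul, hι, hι, ha', pow_one, mul_comm]
  set φ : ResidueField (locAtCentre A₁.toSubring O) →+* R' ⧸ I := Ideal.Quotient.lift _ (π.comp ι) hker with hφdef
  have hφ : ∀ a, φ (residue _ a) = π (ι a) := fun a => Ideal.Quotient.lift_mk _ _ _
  have hDI : ∀ a ∈ I, D₁ a ∈ I := fun a ha => by
    obtain ⟨r, rfl⟩ := Ideal.mem_span_singleton'.mp ha
    rw [Derivation.leibniz, hD₁σ, smul_zero, zero_add, smul_eq_mul]
    exact Ideal.mul_mem_right _ _ (Ideal.mem_span_singleton_self _)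
  obtain ⟨Dq, hDq⟩ := Literature.Barriers.Schanuel.exists_derivation_quotient D₁ I hDI
  have hDφ : ∀ r, Dq (φ r) = 0 := fun r => by
    obtain ⟨a, rfl⟩ := Ideal.Quotient.mk_surjective r
    change Dq (φ (residue _ a)) = 0
    rw [hφ, hDq]
    exact Ideal.Quotient.eq_zero_iff_mem.mpr (hD₁mem a)
  have hDθ : IsUnit (Dq (π τ')) := by rw [hDq, hD₁τ', map_one]; exact isUnit_one
  -- ### `c̄' = C(τ̄')` with `C ≠ 0` of degree `≤ e'`
  set Cp : Polynomial (ResidueField (locAtCentre A₁.toSubring O)) :=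
    ∑ m ∈ G.support, Polynomial.monomial (m 1) (residue _ (G.coeff m)) with hCpdef
  have hCeval : Cp.eval₂ φ (π τ') = π c' := by
    rw [hCpdef, Polynomial.eval₂_finsetSum, hc'def, map_sum]
    refine Finset.sum_congr rfl fun m _ => ?_
    rw [Polynomial.eval₂_monomial, hφ, map_mul, map_pow]
  have hinj : ∀ m ∈ G.support, ∀ m' ∈ G.support, m 1 = m' 1 → m = m' := fun m hm m' hm' h => by
    have h0 : m 0 = m' 0 := by have := hdeg m hm; have := hdeg m' hm'; omega
    ext i
    fin_cases i
    · exact h0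
    · exact h
  have hC0 : Cp ≠ 0 := by
    intro h0
    have hcoef : Cp.coeff (m₀ 1) = residue _ (G.coeff m₀) := by
      rw [hCpdef, Polynomial.finsetSum_coeff, Finset.sum_eq_single m₀]
      · rw [Polynomial.coeff_monomial, if_pos rfl]
      · intro m hm hne
        rw [Polynomial.coeff_monomial, if_neg]
        exact fun h => hne (hinj m hm m₀ hm₀s h)
      · exact fun h => absurd hm₀s h
    rw [h0, Polynomial.coeff_zero] at hcoef
    exact hm₀ ((residue_eq_zero_iff _).mp hcoef.symm)
  have hCdeg : Cp.natDegree < e' + 1 := by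
    rw [Polynomial.natDegree_lt_iff_degree_lt hC0, hCpdef]
    refine lt_of_le_of_lt (Polynomial.degree_sum_le _ _) ?_
    rw [Finset.sup_lt_iff (WithBot.bot_lt_coe _)]
    intro m hm
    refine lt_of_le_of_lt (Polynomial.degree_monomial_le _ _) ?_
    have := hdeg m hm
    exact_mod_cast (show m 1 < e' + 1 by omega)
  have hc'q : π c' ∉ maximalIdeal (R' ⧸ I) ^ (e' + 1) := by
    rw [← hCeval]
    exact SeparableEvalOrder.eval₂_not_mem_pow φ Dq hDφ (π τ') hDθ Cp hC0 hCdeg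
  -- ### Lemma O
  haveI : CharP R' 2 := inferInstance
  have hDF : π (D₁ F) = π c' ^ 2 + π 0 := by
    have h2 : (2 : R') = 0 := CharTwo.two_eq_zero
    have hF' : D₁ F = c' ^ 2 + ι σ * D₁ H' + 2 * (τ' * c' * D₁ c') := by
      rw [hFdef, map_add, Derivation.leibniz, Derivation.leibniz, Derivation.leibniz_pow, hD₁τ', hD₁σ]
      simp only [smul_eq_mul, nsmul_eq_mul, Nat.cast_ofNat]
      ring
    rw [hF', h2, zero_mul, add_zero, map_add, map_mul, hπσ, zero_mul, add_zero, map_pow, map_zero, add_zero]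
  refine ⟨F, hNF, fun h => ?_⟩
  exact RegularOrder.not_sub_sq_mem_pow_of_derivation π hπ D₁ (by omega : 1 ≤ e' + 1) hDF (Ideal.zero_mem _) hc'q h

end Summit.ResolutionOfSingularities.ResolutionOfSingularities.Theorems.SwitchingDichotomy.EvenResidueSigmaChart

end
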